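import Summits.ABC.IUTFork.Thm311RealInd1StripHullFloor
import Summits.ABC.IUTFork.Thm311RealInd1StripHullKit
import HarnessLib

/-!
# [IUTchIII] Thm 3.11 (i) (Ind1)+(Ind2) at `v ∈ 𝕍^non`: IDEAL-SHAPED regions are in general position — modulo `JannsenWingbergMappingClass`,
# at a tame place of odd local degree `≥ 3` the `𝒪_{K_v}`-hull of the print-(Ind1)⊔(Ind2) orbit span of `𝔪_v^{ke+n}` is the container's
# `𝔪_v^{ke+1}`, except possibly for `n = e` at residue degree one

PROOF-ONLY file (abc-iut cell, Cor. 3.12 sub-crew, seat abc-iut-c312-1 = holder of record of the typed [IUTchIII] Thm. 3.11, gen 15; row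
«R19 = C:IND1-STRIP-OV-HULL», C LEAD ruling C-R120 (c); file 3 — the general-position hypothesis of `Thm311RealInd1StripHullFloor` discharged
for the regions [IUTchIII] Cor. 3.12 actually moves: ideals `q^{j²}·𝒪_v`, i.e. balls).  TAKES NO SIDE on [IUTchIII] Cor. 3.12.

* (kit `Thm311RealInd1StripHullKit`: the residue count `residueDegree_le_one_of_forall_exists_norm_sub_algebraMap_lt_one` and the `p`-adic gap.)
* **`coe_span_eq_of_ball_of_jannsenWingbergMappingClass`** (binder `hMC : JannsenWingbergMappingClass`; `p > 2`, `e = e(v|p) ≤ p − 2`,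
  `[K_v:ℚ_p] ≥ 3` odd; content `c ≠ 0`, depth `1 ≤ n ≤ e`, NOT (`n = e` ∧ `f(v|p) = 1`)): for the ball `M = {x : ‖x‖ ≤ ‖c‖·p^{−n/e}}`
  (`= c·𝔪_v^n ⊆ c·log_p(𝒪_v^×) = c·𝔪_v`, content exactly `c`) and EVERY additive subgroup `N ∋ M` closed under the two-step strip orbit and
  inside the ceiling `M + (c·log_p(𝒪_v^×) ∩ Ker Tr)` (the orbit span is: p516833 §1): the `𝒪_{K_v}`-hull of `N` EQUALS the hull of
  Dupuy–Hilado's container span `c·log_p(𝒪_v^×)`, the ball of radius `‖c‖·p^{−1/e}` (`= c·𝔪_v`).  The general-position hypothesis of the floor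
  theorem is DISCHARGED: if no element of the ball had a plane coordinate of maximal norm, the plane part of every element of the ball would
  lie in `p·c·log_p(𝒪_v^×)` (box property), so `c·u·ϖ^n ≡ t_u·y₀ (mod p·c·𝔪_v)` for every unit `u`, whence `u ≡ t_u/t_1 ∈ ℚ_p
  (mod 𝔪_v^{e+1−n})`: impossible for `u = 1 + ϖ` when `n < e`, and forcing `f(v|p) = 1` when `n = e` (kit).
READING (numbers about OUR typed objects, one finite place): modulo the Jannsen–Wingberg presentation with Kondo's mapping-class-group image,
at a TAME place `v ∣ p` of ODD local degree `≥ 3`, print's (Ind1) strip part ⊔ (Ind2) AS TYPED inflates the holomorphic hull of EVERY ideal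
`c·𝔪_v^n` (`1 ≤ n ≤ e`) to the hull `c·𝔪_v` of Dupuy–Hilado's container span — EXACTLY the container's value (abc-iut-w5-d180), a gain of
`n − 1` steps of `𝔪_v` — with ONE possible exception, `n = e` at residue degree `f(v|p) = 1` (the ball `p·c·𝒪_v`), where general position is
one un-pinned bit (the leading term of the radial log-generator).  HONEST SCOPE: conditional on `hMC`; single place; tame; odd local degree;
OUR typing of print's (Ind1)/(Ind2) (THE equivariant lift, THE logarithm; referee F-B28-1 untouched); nothing here computes a tensor-packet hull
or a log-volume; (Ind3) and the log-link untouched; no side taken on [IUTchIII] Cor. 3.12; NO abc claim. [claim: Mochizuki2012, status: disputed];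
[cite: Mochizuki2012, IUTchIII Rmk. 3.9.5 (i) p. 126; Thm. 3.11 (i) p. 154; Cor. 3.12 Step (xi) p. 183; IUTchIV Prop. 1.2 (i) p. 10];
[cite: Kondo2025OuterAutMLF, §3 Thm 3.17, Rem 3.18]; [cite: DupuyHilado2025, §4.9, §4.12]; [cite: SerreLocalFields1979, Ch. III §6, Prop. 13].
typed ≠ proved; a conditional theorem discharges nothing it binds.
-/

set_option autoImplicit false

noncomputable section

open Metric Set
open scoped Pointwise

/-! ## Ideal-shaped regions are in general position; the hull of their print-(Ind1)⊔(Ind2) orbit span -/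

namespace Summit.ABC.IUTFork.Thm311.Real

open NumberField IsDedekindDomain Literature.NumberTheory.NumberFields Literature.IUT.LogVolume
open Literature.NumberTheory.GaloisRepresentations Literature.NumberTheory.GaloisRepresentations.Ultrametric
open Literature.AnabelianGeometry.AbsoluteAnabelian Literature.IUT.HodgeArakelov
open Literature.IUT.HodgeArakelov.AbsTopMonoids

variable {F : Type} [Field F] [NumberField F] (v : HeightOneSpectrum (𝓞 F))

/-- **THE HULL OF THE PRINT-(Ind1)⊔(Ind2) ORBIT SPAN OF AN IDEAL (modulo `JannsenWingbergMappingClass`).**  At a tame place `v ∣ p` (`p > 2`,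
`e = e(v|p) ≤ p − 2`) of ODD local degree `≥ 3`, for a content `c ≠ 0` and a depth `1 ≤ n ≤ e` with NOT (`n = e` ∧ `f(v|p) = 1`): for the ball
`M = {x : ‖x‖ ≤ ‖c‖·p^{−n/e}}` (`= c·𝔪_v^n`) and every additive subgroup `N ∋ M` closed under the two-step strip orbit (`x, ψ x, ψ'(ψ x)`,
`ψ, ψ' ∈ Real.ind1StripOf v (galoisLog v)`) and inside the ceiling `M + (c·log_p(𝒪_v^×) ∩ Ker Tr)`, the `𝒪_{K_v}`-module hull of `N` IS the
hull of Dupuy–Hilado's container span `c·log_p(𝒪_v^×)`, namely `closedBall 0 (‖c‖·p^{−1/e})` (`= c·𝔪_v`).  The general-position hypothesis of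
`exists_basis_hullFloor_of_jannsenWingbergMappingClass` is discharged for balls (box property + a unit count).
[claim: Mochizuki2012, status: disputed] [cite: Mochizuki2012, IUTchIII Thm. 3.11 (i) p. 154; Rmk. 3.9.5 (i) p. 126; Cor. 3.12 Step (xi) p. 183]
[cite: Kondo2025OuterAutMLF, §3 Thm 3.17, Rem 3.18] [cite: DupuyHilado2025, §4.9, §4.12] -/
theorem coe_span_eq_of_ball_of_jannsenWingbergMappingClass (hMC : JannsenWingbergMappingClass)
    (p : ℕ) [Fact p.Prime] (hv : ((p : ℕ) : 𝓞 F) ∈ v.asIdeal) (hp2 : 2 < p)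
    (he : absRamificationIdx p (RescaledCompletion F p v hv) ≤ p - 2) (h3 : 3 ≤ localDeg F v) (hodd : Odd (localDeg F v))
    {c : ℚ_[p]} (hc : c ≠ 0) {n : ℕ} (hn1 : 1 ≤ n) (hne : n ≤ absRamificationIdx p (RescaledCompletion F p v hv))
    (hexc : ¬ (n = absRamificationIdx p (RescaledCompletion F p v hv) ∧ v.asIdeal.inertiaDeg ℤ = 1))
    (N : AddSubgroup (RescaledCompletion F p v hv))
    (hMN : ∀ x : v.adicCompletion F, ‖RescaledCompletion.of F p v hv x‖ ≤
      ‖c‖ * (p : ℝ) ^ (-((n : ℝ) / (absRamificationIdx p (RescaledCompletion F p v hv) : ℝ))) → RescaledCompletion.of F p v hv x ∈ N)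
    (horb : ∀ ψ ∈ ind1StripOf v (galoisLog v), ∀ x : v.adicCompletion F, ‖RescaledCompletion.of F p v hv x‖ ≤
      ‖c‖ * (p : ℝ) ^ (-((n : ℝ) / (absRamificationIdx p (RescaledCompletion F p v hv) : ℝ))) →
        RescaledCompletion.of F p v hv (ψ x) ∈ N ∧
          ∀ ψ' ∈ ind1StripOf v (galoisLog v), RescaledCompletion.of F p v hv (ψ' (ψ x)) ∈ N)
    (hNc : (N : Set (RescaledCompletion F p v hv)) ⊆
      {x | ‖x‖ ≤ ‖c‖ * (p : ℝ) ^ (-((n : ℝ) / (absRamificationIdx p (RescaledCompletion F p v hv) : ℝ)))} +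
        (c • logUnits (RescaledCompletion F p v hv) ∩ {w | Algebra.trace ℚ_[p] (RescaledCompletion F p v hv) w = 0})) :
    (Submodule.span (Valued.integer (RescaledCompletion F p v hv)) (N : Set (RescaledCompletion F p v hv)) :
        Set (RescaledCompletion F p v hv)) =
      Submodule.span (Valued.integer (RescaledCompletion F p v hv)) (c • logUnits (RescaledCompletion F p v hv)) ∧
    (Submodule.span (Valued.integer (RescaledCompletion F p v hv)) (c • logUnits (RescaledCompletion F p v hv)) :
        Set (RescaledCompletion F p v hv)) =
      closedBall 0 (‖c‖ * (p : ℝ) ^ (-(1 / (absRamificationIdx p (RescaledCompletion F p v hv) : ℝ)))) := by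
  obtain ⟨g, hg, y, -, -, -, hbox, hrec, hH⟩ :=
    exists_basis_hullFloor_of_jannsenWingbergMappingClass v hMC p hv hp2 he h3 hodd
  set R := RescaledCompletion F p v hv
  set e := RescaledCompletion.of F p v hv with he_def
  set E := absRamificationIdx p (RescaledCompletion F p v hv) with hE_def
  set r : ℝ := ‖c‖ * (p : ℝ) ^ (-((n : ℝ) / (E : ℝ))) with hr_def
  let pl : Fin g ⊕ Fin g → Fin g × Fin 2 := Sum.elim (fun i => (i, 0)) (fun i => (i, 1))
  let M : Set (v.adicCompletion F) := {x | ‖e x‖ ≤ r}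
  haveI : FiniteDimensional ℚ_[p] R := FiniteDimensional.of_locallyCompactSpace ℚ_[p]
  have hP : p.Prime := Fact.out
  have hp1 : (1 : ℝ) < p := by exact_mod_cast hP.one_lt
  have hp0 : (0 : ℝ) < p := by positivity
  have hE0 : 0 < E := absRamificationIdx_pos p R
  have hE0' : (0 : ℝ) < E := by exact_mod_cast hE0
  have hc0 : 0 < ‖c‖ := norm_pos_iff.mpr hc
  have hr0 : 0 < r := mul_pos hc0 (Real.rpow_pos_of_pos hp0 _)
  have hd2 : 2 ≤ localDeg F v := by omega
  -- tame: `log_p(𝒪_v^×) = {‖z‖ < 1}`; its elements have norm `≤ p^{-1/E}`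
  have hL : ∀ z : R, z ∈ logUnits R ↔ ‖z‖ < 1 := fun z => mem_logUnits_iff_norm_lt_one_of_tame p hp2 he z
  have hLle : ∀ z ∈ logUnits R, ‖z‖ ≤ (p : ℝ) ^ (-(1 / (E : ℝ))) :=
    fun z hz => norm_le_rpow_of_norm_lt_one p R ((hL z).mp hz)
  have hLsmul : ∀ (u : ℚ_[p]) (z : R), ‖u‖ ≤ 1 → z ∈ logUnits R → u • z ∈ logUnits R := by
    intro u z hu hz
    set u' : ℤ_[p] := ⟨u, hu⟩ with hu'
    have h := smul_mem_logUnits p R u' hz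
    rwa [← algebraMap_smul ℚ_[p] u' z] at h
  -- `p^{-n/E} < 1`, hence `r < ‖c‖` and `M ⊆ c·log_p(𝒪_v^×)`
  have hpn : (p : ℝ) ^ (-((n : ℝ) / (E : ℝ))) < 1 :=
    Real.rpow_lt_one_of_one_lt_of_neg hp1 (by
      have : (0 : ℝ) < (n : ℝ) / E := div_pos (by exact_mod_cast hn1) hE0'
      linarith)
  have hMc : ∀ x ∈ M, e x ∈ c • logUnits R := by
    intro x hx
    refine ⟨c⁻¹ • e x, (hL _).mpr ?_, by change c • (c⁻¹ • e x) = e x; rw [smul_smul, mul_inv_cancel₀ hc, one_smul]⟩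
    rw [norm_smul, norm_inv, inv_mul_lt_iff₀ hc0]
    calc ‖e x‖ ≤ r := hx
      _ < ‖c‖ * 1 := mul_lt_mul_of_pos_left hpn hc0
  have hMs : ∀ u : ℚ_[p], ‖u‖ ≤ 1 → ∀ x ∈ M, e.symm (u • e x) ∈ M := by
    intro u hu x hx
    change ‖e (e.symm (u • e x))‖ ≤ r
    rw [RingEquiv.apply_symm_apply, norm_smul]
    calc ‖u‖ * ‖e x‖ ≤ 1 * r := mul_le_mul hu hx (norm_nonneg _) zero_le_one
      _ = r := one_mul r
  have h0M : (0 : v.adicCompletion F) ∈ M := by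
    change ‖e 0‖ ≤ r; rw [map_zero, norm_zero]; exact hr0.le
  -- GENERAL POSITION of the ball `M`
  have hGP : ∃ x₀ ∈ M, ∃ j₀ : Fin g ⊕ Fin g, ∀ z ∈ logUnits R, ∀ k : Fin g ⊕ Fin g,
      ‖y.coord (Sum.inr (pl k)) (c • z)‖ ≤ ‖y.coord (Sum.inr (pl j₀)) (e x₀)‖ := by
    -- a maximal plane coordinate `i` over `log_p(𝒪_v^×)`
    have hLc : IsCompact (logUnits R) := isCompact_logUnits (p := p) R
    have hLne : (logUnits R).Nonempty := ⟨0, zero_mem_logUnits (p := p)⟩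
    have hmax : ∀ k : Fin g ⊕ Fin g, ∃ z ∈ logUnits R, IsMaxOn (fun w => ‖y.coord (Sum.inr (pl k)) w‖) (logUnits R) z := by
      intro k
      exact hLc.exists_isMaxOn hLne
        ((continuous_norm.comp (y.coord (Sum.inr (pl k))).continuous_of_finiteDimensional).continuousOn)
    choose zk hzk hzkmax using hmax
    haveI : Nonempty (Fin g ⊕ Fin g) := by
      have hg1 : 1 ≤ g := by omega
      exact ⟨Sum.inl ⟨0, hg1⟩⟩
    obtain ⟨k₁, -, hk₁⟩ := Finset.exists_max_image Finset.univ
      (fun k : Fin g ⊕ Fin g => ‖y.coord (Sum.inr (pl k)) (zk k)‖) Finset.univ_nonempty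
    set i : ℚ_[p] := y.coord (Sum.inr (pl k₁)) (zk k₁) with hi_def
    have hi : ∀ z ∈ logUnits R, ∀ k : Fin g ⊕ Fin g, ‖y.coord (Sum.inr (pl k)) z‖ ≤ ‖i‖ :=
      fun z hz k => (hzkmax k hz).trans (hk₁ k (Finset.mem_univ k))
    have hiy : ∀ k : Fin g ⊕ Fin g, i • y (Sum.inr (pl k)) ∈ logUnits R := fun k => hbox (zk k₁) (hzk k₁) k₁ k
    by_cases hi0 : i = 0
    · refine ⟨0, h0M, k₁, fun z hz k => ?_⟩
      rw [map_smul, smul_eq_mul, norm_mul]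
      have h := hi z hz k
      rw [hi0, norm_zero] at h
      rw [le_antisymm h (norm_nonneg _), mul_zero]
      exact norm_nonneg _
    by_contra hcon
    push Not at hcon
    -- under `¬GP`: every plane coordinate of every element of the ball is `< ‖c·i‖`, hence `≤ p⁻¹‖c·i‖`
    have hsmall : ∀ x : R, ‖x‖ ≤ r → ∀ j : Fin g ⊕ Fin g,
        ‖y.coord (Sum.inr (pl j)) x‖ ≤ ‖(p : ℚ_[p]) * c * i‖ := by
      intro x hx j
      have hxM : e.symm x ∈ M := by change ‖e (e.symm x)‖ ≤ r; rwa [RingEquiv.apply_symm_apply]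
      obtain ⟨z, hz, k, hlt⟩ := hcon (e.symm x) hxM j
      rw [RingEquiv.apply_symm_apply] at hlt
      have hlt' : ‖y.coord (Sum.inr (pl j)) x‖ < ‖c * i‖ := by
        refine hlt.trans_le ?_
        rw [map_smul, smul_eq_mul, norm_mul, norm_mul]
        exact mul_le_mul_of_nonneg_left (hi z hz k) (norm_nonneg c)
      have h := Hull.padic_norm_le_of_norm_lt hlt'
      rwa [mul_assoc, norm_mul ((p : ℚ_[p])), Padic.norm_p]
    -- hence the plane part of such `x` lies in `(p·c)·log_p(𝒪_v^×)`
    have hpc0 : (p : ℚ_[p]) * c * i ≠ 0 := mul_ne_zero (mul_ne_zero (by exact_mod_cast hP.ne_zero) hc) hi0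
    have hplane : ∀ x : R, ‖x‖ ≤ r →
        x - y.coord (Sum.inl 0) x • y (Sum.inl 0) ∈ ((p : ℚ_[p]) * c) • logUnits R := by
      intro x hx
      have hx' : x - y.coord (Sum.inl 0) x • y (Sum.inl 0) = ∑ k, y.coord (Sum.inr (pl k)) x • y (Sum.inr (pl k)) := by
        rw [sub_eq_iff_eq_add', hrec x]
      rw [hx']
      have hterm : ∀ k, y.coord (Sum.inr (pl k)) x • y (Sum.inr (pl k)) ∈ ((p : ℚ_[p]) * c) • logUnits R := by
        intro k
        set t := y.coord (Sum.inr (pl k)) x with ht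
        set u : ℚ_[p] := t / ((p : ℚ_[p]) * c * i) with hu_def
        have hu : ‖u‖ ≤ 1 := by
          rw [hu_def, norm_div, div_le_one (norm_pos_iff.mpr hpc0)]
          exact hsmall x hx k
        have htu : ((p : ℚ_[p]) * c) * (u * i) = t := by
          rw [hu_def]
          calc (p : ℚ_[p]) * c * (t / ((p : ℚ_[p]) * c * i) * i)
              = t * (((p : ℚ_[p]) * c * i) / ((p : ℚ_[p]) * c * i)) := by ring
            _ = t := by rw [div_self hpc0, mul_one]
        have hmem : (u * i) • y (Sum.inr (pl k)) ∈ logUnits R := by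
          rw [mul_smul]; exact hLsmul u _ hu (hiy k)
        have heq : t • y (Sum.inr (pl k)) = ((p : ℚ_[p]) * c) • ((u * i) • y (Sum.inr (pl k))) := by
          rw [smul_smul, htu]
        rw [heq]
        exact Set.smul_mem_smul_set hmem
      -- `(p·c)·log_p(𝒪_v^×)` is closed under finite sums
      have hadd : ∀ a b : R, a ∈ ((p : ℚ_[p]) * c) • logUnits R → b ∈ ((p : ℚ_[p]) * c) • logUnits R →
          a + b ∈ ((p : ℚ_[p]) * c) • logUnits R := by
        intro a b ha hb
        obtain ⟨a', ha', rfl⟩ := Set.mem_smul_set.mp ha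
        obtain ⟨b', hb', rfl⟩ := Set.mem_smul_set.mp hb
        rw [← smul_add]
        exact Set.smul_mem_smul_set ((logUnitsAddSubgroup p R).add_mem (show a' ∈ logUnitsAddSubgroup p R from ha')
          (show b' ∈ logUnitsAddSubgroup p R from hb'))
      have hsum : ∀ (s : Finset (Fin g ⊕ Fin g)),
          ∑ k ∈ s, y.coord (Sum.inr (pl k)) x • y (Sum.inr (pl k)) ∈ ((p : ℚ_[p]) * c) • logUnits R := by
        intro s
        induction s using Finset.induction_on with
        | empty =>
          rw [Finset.sum_empty, ← smul_zero ((p : ℚ_[p]) * c)]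
          exact Set.smul_mem_smul_set (zero_mem_logUnits (p := p))
        | insert a s ha ih =>
          rw [Finset.sum_insert ha]
          exact hadd _ _ (hterm a) ih
      exact hsum Finset.univ
    have hplane_norm : ∀ x : R, ‖x‖ ≤ r →
        ‖x - y.coord (Sum.inl 0) x • y (Sum.inl 0)‖ ≤ ‖c‖ * (p : ℝ) ^ (-(((E : ℝ) + 1) / (E : ℝ))) := by
      intro x hx
      obtain ⟨z, hz, hzeq⟩ := Set.mem_smul_set.mp (hplane x hx)
      rw [← hzeq, norm_smul, norm_mul, Padic.norm_p]
      have h1 : (p : ℝ)⁻¹ * ‖c‖ * ‖z‖ ≤ (p : ℝ)⁻¹ * ‖c‖ * (p : ℝ) ^ (-(1 / (E : ℝ))) :=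
        mul_le_mul_of_nonneg_left (hLle z hz) (by positivity)
      refine h1.trans (le_of_eq ?_)
      rw [show -(((E : ℝ) + 1) / (E : ℝ)) = (-1 : ℝ) + (-(1 / (E : ℝ))) by field_simp; ring,
        Real.rpow_add hp0, Real.rpow_neg_one]
      ring
    -- a uniformiser `ϖ`, `‖ϖ‖ = p^{-1/E}`, and the elements `x_u = c·(u·ϖ^n)` of the ball
    obtain ⟨ϖ, hϖ⟩ := exists_norm_eq_rpow_neg (p := p) (K := R) 1
    have hϖ' : ‖(ϖ : R)‖ = (p : ℝ) ^ (-(1 / (E : ℝ))) := by rw [hϖ, Int.cast_one]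
    have hϖn : ‖(ϖ : R) ^ n‖ = (p : ℝ) ^ (-((n : ℝ) / (E : ℝ))) := by
      rw [norm_pow, hϖ', ← Real.rpow_natCast, ← Real.rpow_mul hp0.le]
      congr 1; ring
    have hxu_norm : ∀ u : R, ‖u‖ = 1 → ‖c • (u * (ϖ : R) ^ n)‖ = r := by
      intro u hu; rw [norm_smul, norm_mul, hu, one_mul, hϖn]
    have hgap : ‖c‖ * (p : ℝ) ^ (-(((E : ℝ) + 1) / (E : ℝ))) < r := by
      rw [hr_def]
      refine mul_lt_mul_of_pos_left ((Real.rpow_lt_rpow_left_iff hp1).mpr ?_) hc0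
      have hnE : (n : ℝ) ≤ E := by exact_mod_cast hne
      have : (n : ℝ) / E < ((E : ℝ) + 1) / E := by
        rw [div_lt_div_iff_of_pos_right hE0']; linarith
      linarith
    -- the radial coefficient `t_u` and the congruence `u ≡ t_u/t_1 (mod …)`
    have hy0 : y (Sum.inl 0) ≠ 0 := y.ne_zero _
    have hy0' : 0 < ‖y (Sum.inl 0)‖ := norm_pos_iff.mpr hy0
    have ht : ∀ u : R, ‖u‖ = 1 →
        ‖y.coord (Sum.inl 0) (c • (u * (ϖ : R) ^ n))‖ * ‖y (Sum.inl 0)‖ = r := by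
      intro u hu
      set x := c • (u * (ϖ : R) ^ n) with hx_def
      have hx : ‖x‖ = r := hxu_norm u hu
      have hD := hplane_norm x hx.le
      have hlt : ‖-(x - y.coord (Sum.inl 0) x • y (Sum.inl 0))‖ < ‖x‖ := by rw [norm_neg, hx]; exact hD.trans_lt hgap
      have h := IsUltrametricDist.norm_add_eq_max_of_norm_ne_norm hlt.ne'
      rw [max_eq_left hlt.le, hx, show x + -(x - y.coord (Sum.inl 0) x • y (Sum.inl 0)) =
        y.coord (Sum.inl 0) x • y (Sum.inl 0) by abel, norm_smul] at h
      exact h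
    have hcong : ∀ u : R, ‖u‖ = 1 → ∃ s : ℚ_[p], ‖s‖ = 1 ∧
        ‖u - algebraMap ℚ_[p] R s‖ ≤ (p : ℝ) ^ (-(((E : ℝ) + 1 - n) / (E : ℝ))) := by
      intro u hu
      set x₁ := c • ((1 : R) * (ϖ : R) ^ n) with hx₁
      set xu := c • (u * (ϖ : R) ^ n) with hxu
      set t₁ := y.coord (Sum.inl 0) x₁ with ht₁
      set tu := y.coord (Sum.inl 0) xu with htu
      have h1 := ht 1 norm_one
      have hu' := ht u hu
      rw [← hx₁, ← ht₁] at h1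
      rw [← hxu, ← htu] at hu'
      have ht₁0 : t₁ ≠ 0 := by
        intro h0; rw [h0, norm_zero, zero_mul] at h1; exact hr0.ne' h1.symm
      have htn : ‖tu‖ = ‖t₁‖ := by
        have := h1.trans hu'.symm
        exact (mul_right_cancel₀ hy0'.ne' this).symm
      refine ⟨tu / t₁, by rw [norm_div, htn, div_self (norm_ne_zero_iff.mpr ht₁0)], ?_⟩
      -- `xu − (tu/t₁)·x₁ = D_u − (tu/t₁)·D₁`
      have hD1 := hplane_norm x₁ (by rw [hx₁, hxu_norm 1 norm_one])
      have hDu := hplane_norm xu (by rw [hxu, hxu_norm u hu])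
      have hsx : (tu / t₁) • (t₁ • y (Sum.inl 0)) = tu • y (Sum.inl 0) := by
        rw [smul_smul, div_mul_cancel₀ tu ht₁0]
      have hdiff : xu - (tu / t₁) • x₁ =
          (xu - tu • y (Sum.inl 0)) + -((tu / t₁) • (x₁ - t₁ • y (Sum.inl 0))) := by
        rw [smul_sub, hsx]; abel
      have hnorm : ‖xu - (tu / t₁) • x₁‖ ≤ ‖c‖ * (p : ℝ) ^ (-(((E : ℝ) + 1) / (E : ℝ))) := by
        rw [hdiff]
        refine (IsUltrametricDist.norm_add_le_max _ _).trans (max_le hDu ?_)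
        rw [norm_neg, norm_smul, norm_div, htn, div_self (norm_ne_zero_iff.mpr ht₁0), one_mul]
        exact hD1
      -- `xu − (tu/t₁)·x₁ = c • ((u − algebraMap (tu/t₁)) * ϖ^n)`
      have hfac : xu - (tu / t₁) • x₁ = c • ((u - algebraMap ℚ_[p] R (tu / t₁)) * (ϖ : R) ^ n) := by
        rw [hxu, hx₁, one_mul, smul_comm (tu / t₁) c, Algebra.smul_def (tu / t₁), ← smul_sub, ← sub_mul]
      rw [hfac, norm_smul, norm_mul, hϖn] at hnorm
      -- divide by `‖c‖·p^{-n/E}`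
      have hpos : 0 < ‖c‖ * (p : ℝ) ^ (-((n : ℝ) / (E : ℝ))) := hr0
      have key : ‖u - algebraMap ℚ_[p] R (tu / t₁)‖ * (‖c‖ * (p : ℝ) ^ (-((n : ℝ) / (E : ℝ)))) ≤
          (p : ℝ) ^ (-(((E : ℝ) + 1 - n) / (E : ℝ))) * (‖c‖ * (p : ℝ) ^ (-((n : ℝ) / (E : ℝ)))) := by
        have hrw : (p : ℝ) ^ (-(((E : ℝ) + 1 - n) / (E : ℝ))) * (‖c‖ * (p : ℝ) ^ (-((n : ℝ) / (E : ℝ)))) =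
            ‖c‖ * (p : ℝ) ^ (-(((E : ℝ) + 1) / (E : ℝ))) := by
          rw [mul_left_comm, ← Real.rpow_add hp0]
          congr 2; field_simp; ring
        rw [hrw]
        calc ‖u - algebraMap ℚ_[p] R (tu / t₁)‖ * (‖c‖ * (p : ℝ) ^ (-((n : ℝ) / (E : ℝ))))
            = ‖c‖ * (‖u - algebraMap ℚ_[p] R (tu / t₁)‖ * (p : ℝ) ^ (-((n : ℝ) / (E : ℝ)))) := by ring
          _ ≤ ‖c‖ * (p : ℝ) ^ (-(((E : ℝ) + 1) / (E : ℝ))) := hnorm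
      exact le_of_mul_le_mul_right key hpos
    -- conclude: `n < E` is impossible outright, `n = E` forces `f(v|p) = 1`
    rcases hne.lt_or_eq with hlt | heq
    · -- `u = 1 + ϖ`
      have hE2 : 2 ≤ E := by omega
      have hϖ1 : ‖(ϖ : R)‖ < 1 := by
        rw [hϖ']; exact Real.rpow_lt_one_of_one_lt_of_neg hp1 (neg_lt_zero.mpr (by positivity))
      have hu1 : ‖(1 : R) + ϖ‖ = 1 := by
        have hne' : ‖(1 : R)‖ ≠ ‖(ϖ : R)‖ := by rw [norm_one]; exact hϖ1.ne'
        rw [IsUltrametricDist.norm_add_eq_max_of_norm_ne_norm hne', norm_one, max_eq_left hϖ1.le]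
      obtain ⟨s, hs1, hs⟩ := hcong (1 + ϖ) hu1
      have hbound : (p : ℝ) ^ (-(((E : ℝ) + 1 - n) / (E : ℝ))) < ‖(ϖ : R)‖ := by
        rw [hϖ']
        refine (Real.rpow_lt_rpow_left_iff hp1).mpr ?_
        have hn' : (n : ℝ) + 1 ≤ E := by exact_mod_cast hlt
        have : (1 : ℝ) / E < ((E : ℝ) + 1 - n) / E := by
          rw [div_lt_div_iff_of_pos_right hE0']; linarith
        linarith
      have hlt2 : ‖(1 : R) + ϖ - algebraMap ℚ_[p] R s‖ < ‖(ϖ : R)‖ := hs.trans_lt hbound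
      -- `1 + ϖ − s = ϖ + (1 − s)` with `‖1 − s‖ ∈ {1} ∪ [0, p⁻¹]`
      have hrw : (1 : R) + ϖ - algebraMap ℚ_[p] R s = (ϖ : R) + algebraMap ℚ_[p] R (1 - s) := by
        rw [map_sub, map_one]; ring
      rw [hrw] at hlt2
      have h1s : ‖algebraMap ℚ_[p] R (1 - s)‖ = ‖(1 : ℚ_[p]) - s‖ := norm_algebraMap' R _
      have h1s_le : ‖(1 : ℚ_[p]) - s‖ ≤ 1 := by
        rw [sub_eq_add_neg]
        exact (IsUltrametricDist.norm_add_le_max _ _).trans (max_le (by rw [norm_one]) (by rw [norm_neg, hs1]))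
      rcases h1s_le.lt_or_eq with hlt1 | heq1
      · -- `‖1 - s‖ < 1 ⇒ ≤ p⁻¹ < ‖ϖ‖`: then `‖ϖ + (1 - s)‖ = ‖ϖ‖`
        have hle1 : ‖algebraMap ℚ_[p] R (1 - s)‖ < ‖(ϖ : R)‖ := by
          rw [h1s]
          have h := Hull.padic_norm_le_of_norm_lt (show ‖(1 : ℚ_[p]) - s‖ < ‖(1 : ℚ_[p])‖ by rwa [norm_one])
          rw [norm_one, mul_one] at h
          refine h.trans_lt ?_
          rw [hϖ', ← Real.rpow_neg_one]
          refine (Real.rpow_lt_rpow_left_iff hp1).mpr ?_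
          have : (1 : ℝ) / E ≤ 1 / 2 := by
            rw [one_div_le_one_div hE0' (by norm_num)]; exact_mod_cast hE2
          linarith
        have h := IsUltrametricDist.norm_add_eq_max_of_norm_ne_norm hle1.ne'
        rw [max_eq_left hle1.le] at h
        rw [h] at hlt2
        exact lt_irrefl _ hlt2
      · -- `‖1 - s‖ = 1 > ‖ϖ‖`: then `‖ϖ + (1 - s)‖ = 1`
        have hgt : ‖(ϖ : R)‖ < ‖algebraMap ℚ_[p] R (1 - s)‖ := by rw [h1s, heq1]; exact hϖ1
        have h := IsUltrametricDist.norm_add_eq_max_of_norm_ne_norm hgt.ne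
        rw [max_eq_right hgt.le] at h
        rw [h] at hlt2
        exact (lt_irrefl _ (hgt.trans hlt2))
    · -- `n = E`: every unit is congruent to a `p`-adic number mod `𝔪_v`, so `f(v|p) = 1`
      apply hexc
      refine ⟨heq, ?_⟩
      have hf1 : residueDegree p R ≤ 1 := by
        refine Hull.residueDegree_le_one_of_forall_exists_norm_sub_algebraMap_lt_one p R fun u hu => ?_
        obtain ⟨s, -, hs⟩ := hcong u hu
        refine ⟨s, hs.trans_lt (Real.rpow_lt_one_of_one_lt_of_neg hp1 ?_)⟩
        have : (0 : ℝ) < ((E : ℝ) + 1 - n) / E := div_pos (by rw [heq]; linarith) hE0'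
        linarith
      have hf := residueDegree_rescaledCompletion F p v hv
      have hfpos : 0 < v.asIdeal.inertiaDeg ℤ := Ideal.inertiaDeg_pos _ _
      change residueDegree p R = _ at hf
      omega
  -- apply the floor theorem
  obtain ⟨-, -, hhull⟩ := hH c M N hMs hGP (fun x hx => hMN x hx) (fun ψ hψ x hx => horb ψ hψ x hx)
  have heM : e '' M = {x : R | ‖x‖ ≤ r} := by
    ext x
    constructor
    · rintro ⟨x', hx', rfl⟩; exact hx'
    · intro hx; exact ⟨e.symm x, by change ‖e (e.symm x)‖ ≤ r; rwa [RingEquiv.apply_symm_apply], e.apply_symm_apply x⟩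
  have hNc' : (N : Set R) ⊆ e '' M + (c • logUnits R ∩ {w | Algebra.trace ℚ_[p] R w = 0}) := by
    rw [heM]; exact hNc
  have h0 : (0 : R) ∈ {x : R | ‖x‖ ≤ r} := by rw [Set.mem_setOf_eq, norm_zero]; exact hr0.le
  exact ⟨hhull hMc hNc', (coe_span_add_inter_ker_eq_of_tame v p hv hp2 he hd2 c h0
    (by rw [← heM]; rintro _ ⟨x, hx, rfl⟩; exact hMc x hx)).2⟩

end Summit.ABC.IUTFork.Thm311.Real

end
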